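import Literature.Analysis.FunctionSpaces.TorusIntegerEndomorphismCalculus
import Literature.Analysis.FunctionSpaces.TorusFourierCalculus
import Literature.Analysis.FunctionSpaces.TorusSymbolCalculus
import Literature.Analysis.FluidPDE.IsometryInvariance
import HarnessLib

/-!
# Integer-matrix automorphisms of the flat torus: composition, characters and Fourier
# coefficients of pull-backs, conjugated vector fields (divergence, Laplacian)

Analysis/FunctionSpaces support file (all results proved; no definitions, no named facts),
continuing `TorusIntegerEndomorphism` / `TorusIntegerEndomorphismCalculus` (the endomorphism
`x ↦ M • x = Torus.mulVecT M x` of `T^d = (ℝ/ℤ)^d` induced by `M ∈ M_d(ℤ)`, its real matrix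
`M_ℝ = Matrix.toEuclideanCLM (M.map Int.cast)` acting on `ℝ^d`, Haar invariance, chain rule) with
what is needed to let a finite group of lattice automorphisms (e.g. the coordinate reflections
`diag(±1, …, ±1)`, or signed permutation matrices) act on vector fields `u : T^d → ℝ^d` by
CONJUGATION `u ↦ A_ℝ ∘ u ∘ (M • ·)` — the setting of Palais' principle of symmetric criticality for
PDEs on the torus that are invariant under such a group:

* composition: `Torus.mulVecT_one`, `Torus.mulVecT_mul` (`(MN) • x = M • (N • x)`),
  `Torus.mulVecT_mulVecT_of_mul_eq_one`; the same for the real matrices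
  (`Torus.toEuclideanCLM_intCast_mul/_one/_apply_apply_of_mul_eq_one`);
* characters: `Torus.mFourier_mulVecT` — `e_m (M • x) = e_{mM} (x)` with `(mM)_j = ∑_l m_l M_{lj}`
  (`Matrix.vecMul`); hence, for an automorphism (`M' M = 1`), the change of variables
  `∫ g (M • x) dx = ∫ g` WITHOUT measurability assumptions (`Torus.integral_comp_mulVecT_of_mul_eq_one`,
  `x ↦ M • x` is then a measurable equivalence) and the **Fourier coefficients of a pull-back**
  `𝓕(g ∘ M•)(k) = 𝓕g(k M')` (`Torus.mFourierCoeff_comp_mulVecT`); for conjugated complexified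
  vector fields `𝓕(A_ℝ u (M•))(k) = A_ℂ 𝓕u(kM')` (`Torus.mFourierCoeff_complexify_conj_mulVecT`,
  with `Torus.complexify_toEuclideanCLM_intCast`);
* calculus of conjugated fields: `Torus.fderiv_clm_comp` (`D(L ∘ f) = L ∘ Df`),
  `Torus.fderiv_clm_comp_mulVecT`, the divergence `div (M'_ℝ ∘ u ∘ M•)(x) = div u (M • x)` for
  `M M' = 1` (`Torus.divergence_conj_mulVecT`, trace of a conjugate), whence
  `Torus.IsDivFree.conj_mulVecT`; and the **Laplacian of an isometric pull-back**
  `Δ(f ∘ M•)(x) = Δf (M • x)` whenever `M_ℝ` preserves norms (`Torus.laplacian_comp_mulVecT`, no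
  regularity needed; from `FluidPDE.laplacian_comp_linearIsometryEquiv_symm`).

## Mathlib / tree search

Reused: `Torus.mulVecT*`, `Torus.measurePreserving_mulVecT`, `Torus.fderiv_comp_mulVecT`,
`Torus.IsContDiff.comp_mulVecT`, `Torus.mulVecT_proj_eq_toEuclideanCLM`
(`TorusIntegerEndomorphism(Calculus)`); `Torus.divergence_eq_trace_fderiv` (`TorusCalculus`),
`Torus.mFourierCoeff_eq_integral_volume`
(`TorusFourierCalculus`), `Torus.mFourierCoeff_comp_clm` (`TorusSymbolCalculus`),
`FluidPDE.laplacian_comp_linearIsometryEquiv_symm` (`FluidPDE/IsometryInvariance`); Mathlib's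
`Matrix.toEuclideanCLM` (a `⋆`-algebra equivalence, so multiplicative), `Matrix.vecMul_vecMul`,
`LinearMap.trace_comp_comm'`, `MeasurePreserving.integral_comp`,
`LinearIsometry.toLinearIsometryEquiv`. Nothing on characters/Fourier coefficients under `mulVecT`
existed (`lean search 'mFourier.*mulVecT|mulVecT_mul|comp_mulVecT'`: only the files above).

## References

* R. S. Palais, *The principle of symmetric criticality*, Comm. Math. Phys. 69 (1979) 19–30
  (invariance of variational equations under a compact group acting by isometries). [`Palais1979`]
* L. Grafakos, *Classical Fourier Analysis*, 3rd ed., GTM 249 (2014), §3.1.1 (functions on `T^n`,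
  characters `e_m`, automorphisms). [`Grafakos2014`]
-/

noncomputable section

open _root_.MeasureTheory Set Function UnitAddTorus
open scoped BigOperators

namespace Literature.Analysis.FunctionSpaces

namespace Torus

variable {d : Type*} [Fintype d] [DecidableEq d]

/-! ## Composition of the torus actions and of the real matrices -/

omit [DecidableEq d] in
/-- The identity matrix acts as the identity: `1 • x = x`. [folklore] -/
theorem mulVecT_one [DecidableEq d] (x : UnitAddTorus d) : mulVecT (1 : Matrix d d ℤ) x = x := by
  funext l
  rw [mulVecT_apply]
  simp [Matrix.one_apply, ite_smul]

omit [DecidableEq d] in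
/-- **Composition**: `(M N) • x = M • (N • x)` (`x ↦ M • x` is a left action of the monoid
`M_d(ℤ)`). [folklore] -/
theorem mulVecT_mul (M N : Matrix d d ℤ) (x : UnitAddTorus d) :
    mulVecT (M * N) x = mulVecT M (mulVecT N x) := by
  funext l
  simp only [mulVecT_apply, Matrix.mul_apply, Finset.sum_smul, mul_smul, Finset.smul_sum]
  rw [Finset.sum_comm]

/-- A left inverse over `ℤ` undoes the action: `M' M = 1 ⟹ M' • (M • x) = x`. [folklore] -/
theorem mulVecT_mulVecT_of_mul_eq_one {M M' : Matrix d d ℤ} (h : M' * M = 1) (x : UnitAddTorus d) :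
    mulVecT M' (mulVecT M x) = x := by
  rw [← mulVecT_mul, h, mulVecT_one]

/-- The real matrices compose like the integer ones: `(M N)_ℝ = M_ℝ ∘ N_ℝ`. [folklore] -/
theorem toEuclideanCLM_intCast_mul (M N : Matrix d d ℤ) :
    Matrix.toEuclideanCLM (n := d) (𝕜 := ℝ) ((M * N).map (Int.cast : ℤ → ℝ)) =
      (Matrix.toEuclideanCLM (n := d) (𝕜 := ℝ) (M.map (Int.cast : ℤ → ℝ))).comp
        (Matrix.toEuclideanCLM (n := d) (𝕜 := ℝ) (N.map (Int.cast : ℤ → ℝ))) := by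
  rw [show (M * N).map (Int.cast : ℤ → ℝ) = M.map (Int.cast : ℤ → ℝ) * N.map (Int.cast : ℤ → ℝ) from
      Matrix.map_mul (f := Int.castRingHom ℝ), map_mul]
  rfl

/-- `1_ℝ = id`. [folklore] -/
theorem toEuclideanCLM_intCast_one :
    Matrix.toEuclideanCLM (n := d) (𝕜 := ℝ) ((1 : Matrix d d ℤ).map (Int.cast : ℤ → ℝ)) =
      ContinuousLinearMap.id ℝ (EuclideanSpace ℝ d) := by
  rw [Matrix.map_one _ Int.cast_zero Int.cast_one, map_one]
  rfl

/-- `M M' = 1 ⟹ M_ℝ (M'_ℝ v) = v`. [folklore] -/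
theorem toEuclideanCLM_intCast_apply_apply_of_mul_eq_one {M M' : Matrix d d ℤ} (h : M * M' = 1)
    (v : EuclideanSpace ℝ d) :
    Matrix.toEuclideanCLM (n := d) (𝕜 := ℝ) (M.map (Int.cast : ℤ → ℝ))
        (Matrix.toEuclideanCLM (n := d) (𝕜 := ℝ) (M'.map (Int.cast : ℤ → ℝ)) v) = v := by
  rw [← ContinuousLinearMap.comp_apply, ← toEuclideanCLM_intCast_mul, h, toEuclideanCLM_intCast_one]
  rfl

/-- Complexification intertwines the real and the complex matrix of `M`:
`complexify (M_ℝ v) = M_ℂ (complexify v)`. [folklore] -/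
theorem complexify_toEuclideanCLM_intCast (M : Matrix d d ℤ) (v : EuclideanSpace ℝ d) :
    EuclideanSpace.complexify (Matrix.toEuclideanCLM (n := d) (𝕜 := ℝ) (M.map (Int.cast : ℤ → ℝ)) v) =
      Matrix.toEuclideanCLM (n := d) (𝕜 := ℂ) (M.map (Int.cast : ℤ → ℂ)) (EuclideanSpace.complexify v) := by
  ext j
  simp only [EuclideanSpace.complexify_apply, Matrix.ofLp_toEuclideanCLM, Matrix.mulVec, dotProduct,
    Matrix.map_apply]
  push_cast
  rfl

/-! ## Characters and integrals under the action -/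

/-- `e_n (∑ⱼ yⱼ) = ∏ⱼ e_n (yⱼ)`. [folklore] -/
theorem fourier_apply_sum (n : ℤ) {ι : Type*} (s : Finset ι) (y : ι → UnitAddCircle) :
    fourier n (∑ j ∈ s, y j) = ∏ j ∈ s, fourier n (y j) := by
  classical
  induction s using Finset.induction_on with
  | empty => simp
  | insert a s ha ih =>
    -- `e_n (a + b) = e_n (a) e_n (b)` (`Torus.fourier_apply_add` of `TorusAxisAverage`, inlined)
    rw [Finset.sum_insert ha, Finset.prod_insert ha, ← ih]
    simp only [fourier_apply, zsmul_add, AddCircle.toCircle_add, Circle.coe_mul]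

/-- `e_n (m • y) = e_{nm} (y)`. [folklore] -/
theorem fourier_apply_zsmul (n m : ℤ) (y : UnitAddCircle) : fourier n (m • y) = fourier (n * m) y := by
  rw [fourier_apply, fourier_apply, smul_smul]

/-- `∏ₗ e_{nₗ} (y) = e_{∑ₗ nₗ} (y)`. [folklore] -/
theorem prod_fourier_apply {ι : Type*} (s : Finset ι) (n : ι → ℤ) (y : UnitAddCircle) :
    ∏ l ∈ s, fourier (n l) y = fourier (∑ l ∈ s, n l) y := by
  classical
  induction s using Finset.induction_on with
  | empty => simp
  | insert a s ha ih => rw [Finset.sum_insert ha, Finset.prod_insert ha, ih, fourier_add]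

omit [DecidableEq d] in
/-- **Characters under the integer action**: `e_m (M • x) = e_{mM} (x)`, where
`(mM)_j = ∑_l m_l M_{lj}` is `Matrix.vecMul m M` (`e_m (Mx) = exp(2πi m·Mx) = exp(2πi (Mᵀm)·x)`).
[folklore] -/
theorem mFourier_mulVecT (m : d → ℤ) (M : Matrix d d ℤ) (x : UnitAddTorus d) :
    mFourier m (mulVecT M x) = mFourier (Matrix.vecMul m M) x := by
  simp only [mFourier, ContinuousMap.coe_mk, mulVecT_apply]
  simp_rw [fourier_apply_sum, fourier_apply_zsmul]
  rw [Finset.prod_comm]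
  refine Finset.prod_congr rfl fun j _ => ?_
  rw [prod_fourier_apply]
  rfl

/-- **Change of variables along a lattice automorphism, no measurability needed**: if
`M' M = 1` then `∫ g (M • x) dx = ∫ g` for every `g` (`x ↦ M • x` is a measure-preserving
measurable EQUIVALENCE of `T^d`; compare `Torus.integral_comp_mulVecT_add`, which needs
`det M ≠ 0` only but asks for a.e.-strong measurability). [folklore] -/
theorem integral_comp_mulVecT_of_mul_eq_one {E : Type*} [NormedAddCommGroup E] [NormedSpace ℝ E]
    {M M' : Matrix d d ℤ} (h : M' * M = 1) (g : UnitAddTorus d → E) :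
    ∫ x, g (mulVecT M x) = ∫ x, g x := by
  have h' : M * M' = 1 := mul_eq_one_comm.1 h
  let e : UnitAddTorus d ≃ᵐ UnitAddTorus d :=
    { toFun := mulVecT M
      invFun := mulVecT M'
      left_inv := fun x => mulVecT_mulVecT_of_mul_eq_one h x
      right_inv := fun x => mulVecT_mulVecT_of_mul_eq_one h' x
      measurable_toFun := (continuous_mulVecT M).measurable
      measurable_invFun := (continuous_mulVecT M').measurable }
  have hmp : MeasurePreserving (⇑e) volume volume := measurePreserving_mulVecT (Matrix.det_ne_zero_of_left_inverse h)
  exact hmp.integral_comp e.measurableEmbedding g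

/-- **Fourier coefficients of a pull-back along a lattice automorphism**: if `M' M = 1` then
`𝓕(g ∘ M•)(k) = 𝓕g(k M')` (`(kM')_j = ∑_l k_l M'_{lj}`): substitute `x = M' • y` and use
`e_{-k} (M' • y) = e_{-kM'} (y)`. [folklore] -/
theorem mFourierCoeff_comp_mulVecT {E : Type*} [NormedAddCommGroup E] [NormedSpace ℂ E]
    {M M' : Matrix d d ℤ} (h : M' * M = 1) (g : UnitAddTorus d → E) (k : d → ℤ) :
    mFourierCoeff (g ∘ mulVecT M) k = mFourierCoeff g (Matrix.vecMul k M') := by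
  rw [mFourierCoeff_eq_integral_volume, mFourierCoeff_eq_integral_volume,
    ← integral_comp_mulVecT_of_mul_eq_one h (fun y => mFourier (-Matrix.vecMul k M') y • g y)]
  refine integral_congr_ae (ae_of_all _ fun x => ?_)
  simp only [Function.comp_apply]
  rw [mFourier_mulVecT, Matrix.neg_vecMul, Matrix.vecMul_vecMul, h, Matrix.vecMul_one]

omit [DecidableEq d] in
/-- Fourier coefficients of a **conjugated, complexified vector field**: for a continuous
`u : T^d → ℝ^d`, any `A ∈ M_d(ℤ)` and an automorphism `M` (`M' M = 1`),
`𝓕(complexify ∘ (A_ℝ ∘ u ∘ M•))(k) = A_ℂ (𝓕(complexify ∘ u)(k M'))`. [folklore] -/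
theorem mFourierCoeff_complexify_conj_mulVecT [DecidableEq d] {u : UnitAddTorus d → EuclideanSpace ℝ d}
    (hu : Continuous u) {M M' : Matrix d d ℤ} (h : M' * M = 1) (A : Matrix d d ℤ) (k : d → ℤ) :
    mFourierCoeff (EuclideanSpace.complexify ∘ fun y =>
        Matrix.toEuclideanCLM (n := d) (𝕜 := ℝ) (A.map (Int.cast : ℤ → ℝ)) (u (mulVecT M y))) k =
      Matrix.toEuclideanCLM (n := d) (𝕜 := ℂ) (A.map (Int.cast : ℤ → ℂ))
        (mFourierCoeff (EuclideanSpace.complexify ∘ u) (Matrix.vecMul k M')) := by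
  have h1 : (EuclideanSpace.complexify ∘ fun y =>
      Matrix.toEuclideanCLM (n := d) (𝕜 := ℝ) (A.map (Int.cast : ℤ → ℝ)) (u (mulVecT M y))) =
      fun y => Matrix.toEuclideanCLM (n := d) (𝕜 := ℂ) (A.map (Int.cast : ℤ → ℂ))
        (((EuclideanSpace.complexify ∘ u) ∘ mulVecT M) y) := by
    funext y
    exact complexify_toEuclideanCLM_intCast A (u (mulVecT M y))
  have hc : Continuous ((EuclideanSpace.complexify ∘ u) ∘ mulVecT M) :=
    (EuclideanSpace.continuous_complexify.comp hu).comp (continuous_mulVecT M)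
  rw [h1, mFourierCoeff_comp_clm _ hc, mFourierCoeff_comp_mulVecT h]

/-! ## Calculus of conjugated fields -/

variable {F : Type*} [NormedAddCommGroup F] [NormedSpace ℝ F]
variable {G : Type*} [NormedAddCommGroup G] [NormedSpace ℝ G]

omit [DecidableEq d] in
/-- **Chain rule, linear map after**: `D(L ∘ f)(x) = L ∘ Df(x)` for a continuous linear `L` and
`C¹` `f` on the torus. [folklore] -/
theorem fderiv_clm_comp {f : UnitAddTorus d → F} (hf : IsContDiff 1 f) (L : F →L[ℝ] G)
    (x : UnitAddTorus d) :
    Torus.fderiv (fun y => L (f y)) x = L.comp (Torus.fderiv f x) := by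
  unfold Torus.fderiv
  have hd : DifferentiableAt ℝ (liftAt f x) 0 :=
    ((hf.liftAt x).differentiable one_ne_zero).differentiableAt
  exact (L.hasFDerivAt.comp (0 : EuclideanSpace ℝ d) hd.hasFDerivAt).fderiv

/-- **Derivative of a conjugated field**: `D(L ∘ u ∘ M•)(x) = L ∘ Du(M • x) ∘ M_ℝ` for `C¹` `u`.
[folklore] -/
theorem fderiv_clm_comp_mulVecT {u : UnitAddTorus d → F} (hu : IsContDiff 1 u) (L : F →L[ℝ] G)
    (M : Matrix d d ℤ) (x : UnitAddTorus d) :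
    Torus.fderiv (fun y => L (u (mulVecT M y))) x =
      L.comp ((Torus.fderiv u (mulVecT M x)).comp
        (Matrix.toEuclideanCLM (n := d) (𝕜 := ℝ) (M.map (Int.cast : ℤ → ℝ)))) := by
  have h1 : IsContDiff 1 (fun y => u (mulVecT M y)) := hu.comp_mulVecT M
  have h2 := fderiv_comp_mulVecT hu M x
  rw [show (u ∘ mulVecT M) = fun y => u (mulVecT M y) from rfl] at h2
  rw [fderiv_clm_comp h1 L x, h2]

/-- **Divergence of a conjugated vector field**: if `M M' = 1` and `u` is `C¹`, then
`div (M'_ℝ ∘ u ∘ M•)(x) = div u (M • x)` (the divergence is the trace of the derivative, and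
`tr (M'_ℝ ∘ Du ∘ M_ℝ) = tr (Du ∘ M_ℝ ∘ M'_ℝ) = tr Du`). [folklore] -/
theorem divergence_conj_mulVecT {u : UnitAddTorus d → EuclideanSpace ℝ d} (hu : IsContDiff 1 u)
    {M M' : Matrix d d ℤ} (h : M * M' = 1) (x : UnitAddTorus d) :
    divergence (fun y => Matrix.toEuclideanCLM (n := d) (𝕜 := ℝ) (M'.map (Int.cast : ℤ → ℝ))
        (u (mulVecT M y))) x = divergence u (mulVecT M x) := by
  set L := Matrix.toEuclideanCLM (n := d) (𝕜 := ℝ) (M.map (Int.cast : ℤ → ℝ)) with hL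
  set L' := Matrix.toEuclideanCLM (n := d) (𝕜 := ℝ) (M'.map (Int.cast : ℤ → ℝ)) with hL'
  have h1 : IsContDiff 1 (fun y => L' (u (mulVecT M y))) := L'.contDiff.comp (hu.comp_mulVecT M)
  have hLL : L.comp L' = ContinuousLinearMap.id ℝ (EuclideanSpace ℝ d) := by
    rw [hL, hL', ← toEuclideanCLM_intCast_mul, h, toEuclideanCLM_intCast_one]
  rw [divergence_eq_trace_fderiv h1, divergence_eq_trace_fderiv hu, fderiv_clm_comp_mulVecT hu L' M x,
    ← hL, ContinuousLinearMap.toLinearMap_comp, LinearMap.trace_comp_comm', ← ContinuousLinearMap.toLinearMap_comp,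
    ContinuousLinearMap.comp_assoc, hLL, ContinuousLinearMap.comp_id]

/-- **Conjugation by a lattice automorphism preserves divergence-freeness**: if `M M' = 1` and `u`
is `C¹` and divergence free, so is `M'_ℝ ∘ u ∘ M•`. [folklore] -/
theorem IsDivFree.conj_mulVecT {u : UnitAddTorus d → EuclideanSpace ℝ d} (hu : IsContDiff 1 u)
    (hdu : IsDivFree u) {M M' : Matrix d d ℤ} (h : M * M' = 1) :
    IsDivFree (fun y => Matrix.toEuclideanCLM (n := d) (𝕜 := ℝ) (M'.map (Int.cast : ℤ → ℝ))
      (u (mulVecT M y))) := fun x => by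
  rw [divergence_conj_mulVecT hu h, hdu]

/-! ## The Laplacian of an isometric pull-back -/

omit [DecidableEq d] in
/-- An integer matrix whose real matrix preserves norms acts on `ℝ^d` through a linear isometry
EQUIVALENCE (an isometry of a finite-dimensional space onto itself). [folklore] -/
theorem exists_linearIsometryEquiv_of_norm_map [DecidableEq d] (M : Matrix d d ℤ)
    (hM : ∀ v, ‖Matrix.toEuclideanCLM (n := d) (𝕜 := ℝ) (M.map (Int.cast : ℤ → ℝ)) v‖ = ‖v‖) :
    ∃ R : EuclideanSpace ℝ d ≃ₗᵢ[ℝ] EuclideanSpace ℝ d,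
      ∀ v, R v = Matrix.toEuclideanCLM (n := d) (𝕜 := ℝ) (M.map (Int.cast : ℤ → ℝ)) v :=
  ⟨({ toLinearMap := (Matrix.toEuclideanCLM (n := d) (𝕜 := ℝ) (M.map (Int.cast : ℤ → ℝ)) :
          EuclideanSpace ℝ d →ₗ[ℝ] EuclideanSpace ℝ d)
      norm_map' := hM } : EuclideanSpace ℝ d →ₗᵢ[ℝ] EuclideanSpace ℝ d).toLinearIsometryEquiv rfl,
    fun _ => rfl⟩

/-- **The Laplacian commutes with isometric lattice pull-backs**: if `M_ℝ` preserves norms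
(e.g. `M` a coordinate reflection or a signed permutation), then `Δ(f ∘ M•)(x) = Δf (M • x)` for
every `f : T^d → F` (no regularity needed: both sides are the Laplacian of the re-centred lift, and
`liftAt (f ∘ M•) x = liftAt f (M • x) ∘ M_ℝ` with `M_ℝ` a linear isometry;
`FluidPDE.laplacian_comp_linearIsometryEquiv_symm`). [folklore] -/
theorem laplacian_comp_mulVecT {M : Matrix d d ℤ}
    (hM : ∀ v, ‖Matrix.toEuclideanCLM (n := d) (𝕜 := ℝ) (M.map (Int.cast : ℤ → ℝ)) v‖ = ‖v‖)
    (f : UnitAddTorus d → F) (x : UnitAddTorus d) :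
    laplacian (fun y => f (mulVecT M y)) x = laplacian f (mulVecT M x) := by
  obtain ⟨R, hR⟩ := exists_linearIsometryEquiv_of_norm_map M hM
  have hlift : liftAt (fun y => f (mulVecT M y)) x = fun v => liftAt f (mulVecT M x) (R.symm.symm v) := by
    funext v
    simp only [liftAt_apply, LinearIsometryEquiv.symm_symm, hR, map_add, mulVecT_proj_eq_toEuclideanCLM]
  have key := Literature.Analysis.FluidPDE.laplacian_comp_linearIsometryEquiv_symm R.symm
    (liftAt f (mulVecT M x)) 0
  rw [Torus.laplacian, Torus.laplacian, hlift, key, LinearIsometryEquiv.symm_symm, map_zero]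

end Torus

end Literature.Analysis.FunctionSpaces
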